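import Mathlib.Probability.Distributions.Uniform
import Mathlib.Probability.ProbabilityMassFunction.Monad
import Mathlib.Data.Fintype.Pi
import Mathlib.Data.Fintype.Vector
import Mathlib.Computability.Encoding
import Mathlib.Analysis.Asymptotics.SuperpolynomialDecay
import Literature.Computability.Cryptography.StatisticalDistance
import Literature.Computability.Cryptography.OneWayFunctions
import Literature.Computability.Cryptography.Indistinguishability
import Literature.Computability.Cryptography.OracleGames
import Literature.Computability.Complexity.TimeBounds
import Literature.Computability.Complexity.BoolEncodings
import Literature.Computability.Complexity.Randomized
import Literature.Computability.Complexity.Oracle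
import HarnessLib

-- provenance: harness21/H21/H21/Prelude/CryptoQuantFine/PseudorandomFunctions.lean @ 7b3359d (interim HEAD d8f2665); M5 mechanical rewrite
/-!
# Crypto / quantum / fine-grained prelude: pseudorandom functions

Trunk `CryptoQuantFine`, concept C4 (`PseudorandomFunctions`; realises the notion
`prf_definition`).

A *function ensemble* is a family `F n : {0,1}^{κ(n)} × {0,1}^{ℓin(n)} → {0,1}^{ℓout(n)}` of
keyed functions. It is *pseudorandom* (a PRF) if it is efficiently computable and no
probabilistic polynomial-time oracle machine, given the security parameter `1ⁿ` and oracle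
access either to `F n k` for a uniformly random key `k`, or to a uniformly random function
`{0,1}^{ℓin(n)} → {0,1}^{ℓout(n)}`, can tell the two apart with more than negligible advantage.

Contents:

* `FunctionEnsemble` — the type `ℕ → List Bool → List Bool → List Bool` of keyed families
  `(n, key, input) ↦ output`;
* `IsEfficientFamily F κ ℓin ℓout` — polynomial-time evaluation and length discipline;
* `prfRealPMF` / `prfRealProb` — the real game (oracle `F n k`, `k ← U_{κ n}`);
  `prfIdealPMF` / `prfIdealProb` — the ideal game (oracle a uniformly random function table);
  `prfAdvantage := |real − ideal|`;
* `IsPRF F κ ℓin ℓout`, `PRFExist`.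

Mathlib anchors used (searched `PRF`, `[Pp]seudorandom`, `uniformOfFintype`, `PMF.bind`,
`SuperpolynomialDecay`; Mathlib has no pseudorandom functions or oracle games): `PMF`,
`PMF.bind`, `PMF.coe_le_one`, `Asymptotics.SuperpolynomialDecay`,
`Computability.unaryEncodeNat`, `Computability.encodingBoolBool`. H21 anchors: C4a
`OracleAdversary` (`.IsPPT`, `.outputPMF`, `.acceptProb`), `oracleOfFnAt`, `oracleOfTable`,
`randomFunctionPMF`; C1 `uniformBits`; G01 `boolPair`, `PolyTimeComputable`.

## Design notes

* Expectations over the key / the random function are taken *inside* `PMF` via `PMF.bind`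
  (`prfRealPMF`, `prfIdealPMF`), and probabilities are read off as the (real) mass of
  `some true`; this equals `E_k[acceptProb 𝒜 (oracleOfFnAt (ℓin n) (F n k)) n]`.
* `IsEfficientFamily` asks for polynomial-time computability of the uncurried map
  `(n, k, x) ↦ F n k x` on the encoding `boolPair 1ⁿ (boolPair k x)`, polynomial bounds on
  `κ`, `ℓin`, `ℓout`, and the length discipline `|F n k x| = ℓout n` for well-formed `k, x`.
  Goldreich's Def. 3.6.4 is the length-preserving case `κ = ℓin = ℓout = id` (`PRFExist`).
* Ill-formed oracle queries are answered by `[]` in both games (`oracleOfFnAt`,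
  `oracleOfTable`), so the adversary gains nothing from them.

## References

* O. Goldreich, S. Goldwasser, S. Micali, *How to construct random functions*, J. ACM 33
  (1986), §3 (Def. of poly-random collections).
* O. Goldreich, *Foundations of Cryptography I*, CUP 2001, §3.6, Def. 3.6.3 (efficiently
  computable function ensembles), Def. 3.6.4 (pseudorandom function ensembles).
-/

namespace Literature.Computability.Cryptography

open Filter Asymptotics _root_.Computability Complexity

/-! ### Function ensembles -/

/-- A *function ensemble* (keyed function family): `F n k x` is the value of the `n`-th
function with key `k` on input `x`; intended domain `k ∈ {0,1}^{κ(n)}`, `x ∈ {0,1}^{ℓin(n)}`,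
values in `{0,1}^{ℓout(n)}`. [Goldreich 2001, §3.6.1, Def. 3.6.3; GGM 1986, §3] [cite: Goldreich2001, §3.6.1  Def. 3.6.3] -/
abbrev FunctionEnsemble : Type := ℕ → List Bool → List Bool → List Bool

/-- `IsEfficientFamily F κ ℓin ℓout`: the function ensemble `F` is *efficiently computable*
with key length `κ`, input length `ℓin` and output length `ℓout`: the uncurried evaluation map
`(n, k, x) ↦ F n k x` is polynomial-time computable on the encoding `boolPair 1ⁿ (boolPair k x)`;
the length functions `κ, ℓin, ℓout` are polynomially bounded; and `F n` maps well-formed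
`(k, x)` (of lengths `κ n`, `ℓin n`) to strings of length `ℓout n`.
[Goldreich 2001, Def. 3.6.3 (efficiently computable function ensembles); GGM 1986, §3] [cite: Goldreich2001, Def. 3.6.3 (efficiently computable funct] -/
def IsEfficientFamily (F : FunctionEnsemble) (κ ℓin ℓout : ℕ → ℕ) : Prop :=
  PolyTimeComputable
      (fun p : ℕ × List Bool × List Bool =>
        boolPair (unaryEncodeNat p.1) (boolPair p.2.1 p.2.2))
      (id : List Bool → List Bool) (fun p => F p.1 p.2.1 p.2.2) ∧
    (∃ q : Polynomial ℕ, ∀ n, κ n ≤ q.eval n ∧ ℓin n ≤ q.eval n ∧ ℓout n ≤ q.eval n) ∧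
    ∀ n k x, k.length = κ n → x.length = ℓin n → (F n k x).length = ℓout n

/-! ### The PRF distinguishing game -/

/-- The output law of the *real* PRF game at security parameter `n`: draw a key
`k ← U_{κ(n)}` and run the oracle adversary `𝒜` on `1ⁿ` with oracle access to `F n k` on
queries of length `ℓin n` (`oracleOfFnAt`). [Goldreich 2001, Def. 3.6.4; GGM 1986, §3] [cite: Goldreich2001, Def. 3.6.4] -/
noncomputable def prfRealPMF (F : FunctionEnsemble) (κ ℓin : ℕ → ℕ) (𝒜 : OracleAdversary Bool)
    (n : ℕ) : PMF (Option Bool) :=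
  (uniformBits (κ n)).bind fun k => 𝒜.outputPMF (oracleOfFnAt (ℓin n) (F n k)) (unaryEncodeNat n)

/-- `prfRealProb F κ ℓin 𝒜 n = Pr_{k ← U_{κ n}}[𝒜^{F n k}(1ⁿ) = 1]`, the acceptance probability
in the real PRF game (a real number in `[0,1]`); equals the expectation over `k` of
`𝒜.acceptProb (oracleOfFnAt (ℓin n) (F n k)) n`. [Goldreich 2001, Def. 3.6.4] [cite: Goldreich2001, Def. 3.6.4] -/
noncomputable def prfRealProb (F : FunctionEnsemble) (κ ℓin : ℕ → ℕ) (𝒜 : OracleAdversary Bool)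
    (n : ℕ) : ℝ :=
  (prfRealPMF F κ ℓin 𝒜 n (some true)).toReal

/-- The output law of the *ideal* PRF game at security parameter `n`: draw a uniformly random
function table `H : {0,1}^{ℓin n} → {0,1}^{ℓout n}` (`randomFunctionPMF`) and run `𝒜` on `1ⁿ`
with oracle `oracleOfTable H`. [Goldreich 2001, Def. 3.6.4 (the uniform function ensemble);
GGM 1986, §3] [cite: Goldreich2001, Def. 3.6.4 (the uniform function ensembl] -/
noncomputable def prfIdealPMF (ℓin ℓout : ℕ → ℕ) (𝒜 : OracleAdversary Bool) (n : ℕ) :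
    PMF (Option Bool) :=
  (randomFunctionPMF (ℓin n) (ℓout n)).bind fun H =>
    𝒜.outputPMF (oracleOfTable H) (unaryEncodeNat n)

/-- `prfIdealProb ℓin ℓout 𝒜 n = Pr_{H}[𝒜^{H}(1ⁿ) = 1]` for a uniformly random function
`H : {0,1}^{ℓin n} → {0,1}^{ℓout n}`, the acceptance probability in the ideal PRF game.
[Goldreich 2001, Def. 3.6.4] [cite: Goldreich2001, Def. 3.6.4] -/
noncomputable def prfIdealProb (ℓin ℓout : ℕ → ℕ) (𝒜 : OracleAdversary Bool) (n : ℕ) : ℝ :=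
  (prfIdealPMF ℓin ℓout 𝒜 n (some true)).toReal

/-- The PRF distinguishing advantage of `𝒜` against `F` at security parameter `n`:
`|Pr[𝒜^{F n k}(1ⁿ) = 1] − Pr[𝒜^{H}(1ⁿ) = 1]|`. [Goldreich 2001, Def. 3.6.4; GGM 1986, §3] [cite: Goldreich2001, Def. 3.6.4] -/
noncomputable def prfAdvantage (F : FunctionEnsemble) (κ ℓin ℓout : ℕ → ℕ)
    (𝒜 : OracleAdversary Bool) (n : ℕ) : ℝ :=
  |prfRealProb F κ ℓin 𝒜 n - prfIdealProb ℓin ℓout 𝒜 n|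

/-! ### Pseudorandom function ensembles -/

/-- `IsPRF F κ ℓin ℓout`: `F` is a *pseudorandom function ensemble* with key/input/output
lengths `κ, ℓin, ℓout` — it is efficiently computable and every probabilistic polynomial-time
oracle adversary has negligible (superpolynomially decaying) distinguishing advantage between
oracle access to `F n k` (`k ← U_{κ n}`) and to a uniformly random function
`{0,1}^{ℓin n} → {0,1}^{ℓout n}`.
[Goldreich–Goldwasser–Micali 1986, §3; Goldreich 2001, Def. 3.6.4] [cite: GoldreichGoldwasserMicali1986, §3] -/
def IsPRF (F : FunctionEnsemble) (κ ℓin ℓout : ℕ → ℕ) : Prop :=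
  IsEfficientFamily F κ ℓin ℓout ∧
    ∀ 𝒜 : OracleAdversary Bool, 𝒜.IsPPT encodingBoolBool →
      SuperpolynomialDecay atTop (fun n : ℕ => (n : ℝ)) (prfAdvantage F κ ℓin ℓout 𝒜)

/-- `PRFExist`: length-preserving pseudorandom function ensembles
`F n : {0,1}ⁿ × {0,1}ⁿ → {0,1}ⁿ` exist (the existence claim for the notion of Goldreich's
Def. 3.6.4 in the length-preserving case `ℓ = id`, the case Construction 3.6.5 produces).
**Status: an open existence hypothesis, not a theorem in print** — a sibling of `OWFExist` and
`PRGExist` (a PRF yields a PRG, hence a one-way function, hence `P ≠ NP`; Goldreich 2001,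
Cor. 3.6.8 and Exercise 28 of Ch. 3). What is proved in print is *conditional*: a pseudorandom
generator yields such an ensemble (GGM 1986, Thm. 3; Goldreich 2001, Thm. 3.6.6), hence so does a
one-way function (Goldreich 2001, Cor. 3.6.7, via Thm. 3.5.12) — vendored as
`Literature.Computability.Cryptography.PRFExist_of_PRGExist` (`Pseudorandomness.lean`) and, at the level of the
explicit tree construction, as `Literature.Computability.Cryptography.GGM1986_thm3` with the proved corollaries
`PRFExist_of_exists_isLengthDoublingPRG`, `PRFExist_of_exists_isPRG_succ` (`GGM.lean`). This Prop
is therefore not to be discharged unconditionally; it is used as a hypothesis.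
[Goldreich 2001, Def. 3.6.4 (the notion), Cor. 3.6.7–3.6.8 (conditional existence); GGM 1986,
§3.1 and Thm. 3] [cite: Goldreich2001, Def. 3.6.4] -/
def PRFExist : Prop := ∃ F : FunctionEnsemble, IsPRF F id id id

/-! ### API -/

/-- `prfRealProb` is nonnegative. [Goldreich 2001, Def. 3.6.4] [cite: Goldreich2001, Def. 3.6.4] -/
theorem prfRealProb_nonneg (F : FunctionEnsemble) (κ ℓin : ℕ → ℕ) (𝒜 : OracleAdversary Bool)
    (n : ℕ) : 0 ≤ prfRealProb F κ ℓin 𝒜 n :=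
  ENNReal.toReal_nonneg

/-- `prfRealProb` is at most `1`. [Goldreich 2001, Def. 3.6.4; Mathlib `PMF.coe_le_one`] [cite: Goldreich2001, Def. 3.6.4] -/
theorem prfRealProb_le_one (F : FunctionEnsemble) (κ ℓin : ℕ → ℕ) (𝒜 : OracleAdversary Bool)
    (n : ℕ) : prfRealProb F κ ℓin 𝒜 n ≤ 1 :=
  ENNReal.toReal_le_of_le_ofReal zero_le_one (by simpa using PMF.coe_le_one _ _)

/-- `prfIdealProb` is nonnegative. [Goldreich 2001, Def. 3.6.4] [cite: Goldreich2001, Def. 3.6.4] -/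
theorem prfIdealProb_nonneg (ℓin ℓout : ℕ → ℕ) (𝒜 : OracleAdversary Bool) (n : ℕ) :
    0 ≤ prfIdealProb ℓin ℓout 𝒜 n :=
  ENNReal.toReal_nonneg

/-- `prfIdealProb` is at most `1`. [Goldreich 2001, Def. 3.6.4; Mathlib `PMF.coe_le_one`] [cite: Goldreich2001, Def. 3.6.4] -/
theorem prfIdealProb_le_one (ℓin ℓout : ℕ → ℕ) (𝒜 : OracleAdversary Bool) (n : ℕ) :
    prfIdealProb ℓin ℓout 𝒜 n ≤ 1 :=
  ENNReal.toReal_le_of_le_ofReal zero_le_one (by simpa using PMF.coe_le_one _ _)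

/-- The PRF advantage is nonnegative. [Goldreich 2001, Def. 3.6.4] [cite: Goldreich2001, Def. 3.6.4] -/
theorem prfAdvantage_nonneg (F : FunctionEnsemble) (κ ℓin ℓout : ℕ → ℕ)
    (𝒜 : OracleAdversary Bool) (n : ℕ) : 0 ≤ prfAdvantage F κ ℓin ℓout 𝒜 n :=
  abs_nonneg _

/-- The PRF advantage is at most `1` (both probabilities lie in `[0,1]`).
[Goldreich 2001, Def. 3.6.4] [cite: Goldreich2001, Def. 3.6.4] -/
theorem prfAdvantage_le_one (F : FunctionEnsemble) (κ ℓin ℓout : ℕ → ℕ)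
    (𝒜 : OracleAdversary Bool) (n : ℕ) : prfAdvantage F κ ℓin ℓout 𝒜 n ≤ 1 := by
  unfold prfAdvantage
  have h₁ := prfRealProb_nonneg F κ ℓin 𝒜 n
  have h₂ := prfRealProb_le_one F κ ℓin 𝒜 n
  have h₃ := prfIdealProb_nonneg ℓin ℓout 𝒜 n
  have h₄ := prfIdealProb_le_one ℓin ℓout 𝒜 n
  rw [abs_le]
  constructor <;> linarith

/-- The real-game probability is the expectation over the key of the C4a acceptance
probability: `prfRealProb F κ ℓin 𝒜 n = ∑' k, (U_{κ n} k) · acceptProb 𝒜 (F n k)-oracle n`.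
[Goldreich 2001, Def. 3.6.4; Mathlib `PMF.bind_apply`] [cite: Goldreich2001, Def. 3.6.4] -/
theorem prfRealProb_eq_tsum (F : FunctionEnsemble) (κ ℓin : ℕ → ℕ) (𝒜 : OracleAdversary Bool)
    (n : ℕ) :
    prfRealProb F κ ℓin 𝒜 n =
      ∑' k : List Bool, (uniformBits (κ n) k).toReal *
        𝒜.acceptProb (oracleOfFnAt (ℓin n) (F n k)) n := by
  rw [prfRealProb, prfRealPMF, PMF.bind_apply, ENNReal.tsum_toReal_eq]
  · simp_rw [ENNReal.toReal_mul]
    rfl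
  · exact fun a => ENNReal.mul_ne_top (PMF.apply_ne_top _ _) (PMF.apply_ne_top _ _)

/-- The ideal-game probability is the expectation over the random function table of the C4a
acceptance probability. [Goldreich 2001, Def. 3.6.4; Mathlib `PMF.bind_apply`] [cite: Goldreich2001, Def. 3.6.4] -/
theorem prfIdealProb_eq_tsum (ℓin ℓout : ℕ → ℕ) (𝒜 : OracleAdversary Bool) (n : ℕ) :
    prfIdealProb ℓin ℓout 𝒜 n =
      ∑' H : (List.Vector Bool (ℓin n) → List.Vector Bool (ℓout n)),
        (randomFunctionPMF (ℓin n) (ℓout n) H).toReal * 𝒜.acceptProb (oracleOfTable H) n := by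
  rw [prfIdealProb, prfIdealPMF, PMF.bind_apply, ENNReal.tsum_toReal_eq]
  · simp_rw [ENNReal.toReal_mul]
    rfl
  · exact fun a => ENNReal.mul_ne_top (PMF.apply_ne_top _ _) (PMF.apply_ne_top _ _)

end Literature.Computability.Cryptography
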